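import Mathlib
import Literature.Geometry.Symplectic.JHolomorphicLocalIntersections
import Literature.Geometry.Symplectic.JHolomorphicChartLocalization
import Literature.Geometry.Symplectic.JHolomorphicChartLocalisation
import HarnessLib

/-!
# Local branch dichotomy of a `J`-holomorphic germ from the representation formula (Wendl, Thm. 2.88)

The named fact `Literature.Geometry.Symplectic.jHolomorphic_localBranchDichotomy`
(`Literature/Geometry/Symplectic/JHolomorphicLocalIntersections.lean`; C. Wendl, *Lectures on
Holomorphic Curves in Symplectic and Contact Geometry*, arXiv:1011.1690, Thm. 2.88 = C. Wendl,
*Lectures on Contact 3-Manifolds, Holomorphic Curves and Intersection Theory* (2020), App. B,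
Prop. B.41, in dichotomy form) says: a smooth `J`-holomorphic `G : ℂ → V` into a smooth almost
complex `4`-manifold which is not locally constant at `z₀` is EITHER injective on a disc about
`z₀` and immersed on the punctured disc, OR every point `t ≠ z₀` near `z₀` has a partner `s ≠ t`
near `z₀` with `G s = G t`.

The published proof (Wendl 2020, proof of Prop. B.41, first paragraph; 2010 notes, proof of
Thm. 2.88) runs on top of the **local representation formula** (Wendl 2020 Thm. B.23 = 2010
Thm. 2.85, a weak Micallef–White theorem — "contains most of the hard work"): in a smooth chart
`Θ` of the target about `G z₀` and a `C¹` chart `ξ` of the domain about `z₀` (smooth off `z₀`),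
`Θ ∘ G ∘ ξ⁻¹ (w) = (w^k, û(w))` with `û ∈ C¹`, `û = O(|w|^{k+1})`, and for each rotation
`w ↦ e^{2πiℓ/k} w` either `û(e^{2πiℓ/k} w) ≡ û(w)` near `0` or
`û(e^{2πiℓ/k} w) - û(w) = C w^m + o(|w|^m)` with `C ≠ 0`. Then self-intersections `G t = G s`,
`s ≠ t`, correspond to roots of unity `ζ ≠ 1` with `ξ s = ζ ξ t` and `û(ζ ξ t) = û(ξ t)`: if some
nontrivial rotation leaves `û` invariant, `s = ξ⁻¹(ζ ξ t)` is a partner of every `t` (as close to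
`z₀` as desired), otherwise there are no self-intersections near `z₀`, and `w ↦ w^k` is immersive
off `0`.

This file PROVES that derivation:

* `localBranch_partners_of_rotationInvariant`, `localBranch_injOn_of_rotations_ne`,
  `localBranchDichotomy_flat_of_representation` — the flat dichotomy from the representation data
  (Prop. B.41, proof, ¶1), for maps `u : ℂ → F` into any real normed space;
* `jHolomorphic_localBranchDichotomy_of_representationFormula` — the named fact
  `jHolomorphic_localBranchDichotomy` FROM the representation formula, the latter taken as an
  explicit hypothesis `hX` spelled out in the flat vocabulary of the tree (an open `U ⊆ F`,
  `dim F = 4`, carrying a smooth operator field `J` with `J² = -1`; a smooth `J`-holomorphic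
  `u` on a disc mapped into `U`, `fderiv ℝ u z (iα) = J (u z) (fderiv ℝ u z α)`, cf.
  `Literature.Geometry.Symplectic.sheet_dichotomy`, `jHolomorphicFlat_uniqueContinuation_const`).
  The chart localisation is `exists_coordinateACS_global` / `exists_chartCurve_global`
  (`JHolomorphicChartLocalization.lean`) and `ChartLocalisation.fderiv_extChartAt_comp_apply`
  (`JHolomorphicChartLocalisation.lean`).

Nothing new is asserted: the representation formula is NOT vendored here as a named fact (D-0026:
the proving unit of `jHolomorphic_localBranchDichotomy` may not mint facts); it is the statement
an eventual discharge `jHolomorphic_localBranchDichotomy_holds` has to supply (Wendl 2020 §B.1–B.2: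
similarity principle for Cauchy–Riemann operators of low regularity on bundles, `L^p` elliptic
regularity, local existence of `J`-discs with prescribed tangent, normal push-offs and cylindrical
rescaling — none of it in the tree yet). Design: `C¹` (not `C^∞`) domain chart as printed in the
2020 book (the 2010 notes' smooth chart in Thm. 2.85 is not attainable in general); radii in the
`∀ r, ∃ r'` form of the fact; roots of unity through `Complex.mem_rootsOfUnity`.

## References

* C. Wendl, *Lectures on Contact 3-Manifolds, Holomorphic Curves and Intersection Theory*,
  Cambridge Tracts in Math. 220 (2020), App. B: Thm. B.23, §B.2.3–B.2.5, Prop. B.41 and its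
  proof. [Wendl2020]
* C. Wendl, *Lectures on Holomorphic Curves in Symplectic and Contact Geometry*,
  arXiv:1011.1690 (2010), Thm. 2.85, Thm. 2.88 and its proof. [WendlLectures2010]
* M. J. Micallef, B. White, *The structure of branch points in minimal surfaces and in
  pseudoholomorphic curves*, Ann. of Math. (2) 141 (1995), Thm. 7.1. [MicallefWhite1995]
* D. McDuff, *The local behaviour of holomorphic curves in almost complex 4-manifolds*,
  J. Differential Geom. 34 (1991), Lemma 2.7, Lemma 5.3. [McDuff1991LocalBehaviour]
-/

noncomputable section

open scoped ContDiff Topology Manifold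
open Set Function Metric Filter Asymptotics

namespace Literature.Geometry.Symplectic

/-! ### Elementary helpers -/

section Helpers

variable {E E' : Type*} [NormedAddCommGroup E] [NormedSpace ℝ E] [NormedAddCommGroup E']
  [NormedSpace ℝ E']

/-- A map with a differentiable local left inverse has injective derivative. [folklore] -/
theorem injective_fderiv_of_eventually_leftInverse {f : E → E'} {g : E' → E} {z : E}
    (hf : DifferentiableAt ℝ f z) (hg : DifferentiableAt ℝ g (f z))
    (h : ∀ᶠ x in 𝓝 z, g (f x) = x) : Injective (fderiv ℝ f z) := by
  have hcomp : fderiv ℝ (g ∘ f) z = (fderiv ℝ g (f z)).comp (fderiv ℝ f z) := fderiv_comp z hg hf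
  have hid : fderiv ℝ (g ∘ f) z = ContinuousLinearMap.id ℝ E := by
    have heq : (g ∘ f) =ᶠ[𝓝 z] id := h.mono fun x hx => by simpa using hx
    rw [heq.fderiv_eq, fderiv_id]
  intro v w hvw
  have hv : (fderiv ℝ g (f z)) (fderiv ℝ f z v) = v := by
    simpa using (DFunLike.congr_fun (hcomp.symm.trans hid) v)
  have hw : (fderiv ℝ g (f z)) (fderiv ℝ f z w) = w := by
    simpa using (DFunLike.congr_fun (hcomp.symm.trans hid) w)
  rw [← hv, ← hw, hvw]

end Helpers

/-- If `f w - C w^m = o(|w|^m)` at `0` with `C ≠ 0`, then `f` has no zeros on a punctured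
neighbourhood of `0`. [folklore] -/
theorem eventually_ne_zero_of_isLittleO_sub_mul_pow {f : ℂ → ℂ} {C : ℂ} {m : ℕ} (hC : C ≠ 0)
    (h : (fun w : ℂ => f w - C * w ^ m) =o[𝓝 (0 : ℂ)] fun w : ℂ => ‖w‖ ^ m) :
    ∀ᶠ w in 𝓝[≠] (0 : ℂ), f w ≠ 0 := by
  have hc : 0 < ‖C‖ / 2 := by positivity
  have hev := h.def hc
  rw [eventually_nhdsWithin_iff]
  filter_upwards [hev] with w hw hw0 hf0
  rw [hf0, zero_sub, norm_neg, norm_mul, norm_pow,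
    Real.norm_of_nonneg (pow_nonneg (norm_nonneg _) _)] at hw
  have hw0' : w ≠ 0 := hw0
  have hpos : 0 < ‖w‖ ^ m := pow_pos (norm_pos_iff.2 hw0') m
  nlinarith [norm_pos_iff.2 hC]

/-- The real derivative of `w ↦ (w^k, g w)` at a point `w ≠ 0` where `g` is differentiable is
injective (`k ≠ 0`): its first component is multiplication by `k w^{k-1} ≠ 0`. [folklore] -/
theorem injective_fderiv_pow_prodMk {g : ℂ → ℂ} {w : ℂ} {k : ℕ} (hk : k ≠ 0) (hw : w ≠ 0)
    (hg : DifferentiableAt ℝ g w) :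
    Injective (fderiv ℝ (fun z : ℂ => (z ^ k, g z)) w) := by
  have hpow : HasFDerivAt (fun z : ℂ => z ^ k)
      ((ContinuousLinearMap.smulRight (1 : ℂ →L[ℂ] ℂ) ((k : ℂ) * w ^ (k - 1))).restrictScalars ℝ)
      w :=
    (hasDerivAt_pow k w).hasFDerivAt.restrictScalars ℝ
  have hN : HasFDerivAt (fun z : ℂ => (z ^ k, g z))
      (((ContinuousLinearMap.smulRight (1 : ℂ →L[ℂ] ℂ) ((k : ℂ) * w ^ (k - 1))).restrictScalars
        ℝ).prod (fderiv ℝ g w)) w :=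
    hpow.prodMk hg.hasFDerivAt
  rw [hN.fderiv]
  intro v v' hvv'
  have h1 : v • ((k : ℂ) * w ^ (k - 1)) = v' • ((k : ℂ) * w ^ (k - 1)) := by
    simpa using congr_arg Prod.fst hvv'
  rw [smul_eq_mul, smul_eq_mul] at h1
  have hne : (k : ℂ) * w ^ (k - 1) ≠ 0 :=
    mul_ne_zero (Nat.cast_ne_zero.2 hk) (pow_ne_zero _ hw)
  exact mul_right_cancel₀ hne h1

/-! ### The flat dichotomy from the representation formula -/

section Flat

variable {F : Type*} [NormedAddCommGroup F]

/-- **Branched case.** If, in the representation `Θ (u z) = ((ξ z)^k, û (ξ z))` near `z₀`, the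
normal coordinate is invariant near `0` under a nontrivial `k`-th root of unity `ζ`
(`û (ζ w) = û w`), then every `t ≠ z₀` close to `z₀` has a partner `s ≠ t`, as close to `z₀` as
desired, with `u s = u t` — namely `s = ξ⁻¹ (ζ ξ t)` (Wendl 2020, proof of Prop. B.41).
[cite: Wendl2020, App. B, proof of Prop. B.41] -/
theorem localBranch_partners_of_rotationInvariant {u : ℂ → F} {z₀ : ℂ} {k : ℕ}
    {Θ : OpenPartialHomeomorph F (ℂ × ℂ)} {ξ : OpenPartialHomeomorph ℂ ℂ} {uhat : ℂ → ℂ} {ρ : ℝ}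
    {ζ : ℂ} (hρ : 0 < ρ) (hξsrc : ball z₀ ρ ⊆ ξ.source) (hξ0 : ξ z₀ = 0)
    (hrep : ∀ z ∈ ball z₀ ρ, u z ∈ Θ.source ∧ Θ (u z) = ((ξ z) ^ k, uhat (ξ z)))
    (hζk : ζ ^ k = 1) (hζ1 : ζ ≠ 1) (hinv : ∀ᶠ w in 𝓝 (0 : ℂ), uhat (ζ * w) = uhat w) :
    ∀ r : ℝ, 0 < r → ∃ r' : ℝ, 0 < r' ∧
      ∀ t ∈ ball z₀ r', t ≠ z₀ → ∃ s ∈ ball z₀ r, s ≠ t ∧ u s = u t := by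
  intro r hr
  have hz₀src : z₀ ∈ ξ.source := hξsrc (mem_ball_self hρ)
  have hξcont : ContinuousAt ξ z₀ := ξ.continuousAt hz₀src
  have hξtend : Tendsto ξ (𝓝 z₀) (𝓝 0) := by simpa [hξ0] using hξcont.tendsto
  -- `g t = ζ ξ t → 0` and `P t = ξ⁻¹ (ζ ξ t) → z₀`
  have hgtend : Tendsto (fun t => ζ * ξ t) (𝓝 z₀) (𝓝 0) := by
    simpa using hξtend.const_mul ζ
  have h0tgt : (0 : ℂ) ∈ ξ.target := by simpa [hξ0] using ξ.map_source hz₀src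
  have hPtend : Tendsto (fun t => ξ.symm (ζ * ξ t)) (𝓝 z₀) (𝓝 z₀) := by
    have h := (ξ.continuousAt_symm h0tgt).tendsto.comp hgtend
    have hsymm0 : ξ.symm 0 = z₀ := by rw [← hξ0]; exact ξ.left_inv hz₀src
    simpa [Function.comp_def, hsymm0] using h
  -- gather the eventualities at `z₀`
  have e1 : ∀ᶠ t in 𝓝 z₀, t ∈ ball z₀ ρ := isOpen_ball.mem_nhds (mem_ball_self hρ)
  have e2 : ∀ᶠ t in 𝓝 z₀, ζ * ξ t ∈ ξ.target := hgtend (ξ.open_target.mem_nhds h0tgt)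
  have e3 : ∀ᶠ t in 𝓝 z₀, ξ.symm (ζ * ξ t) ∈ ball z₀ (min r ρ) :=
    hPtend (isOpen_ball.mem_nhds (mem_ball_self (lt_min hr hρ)))
  have e4 : ∀ᶠ t in 𝓝 z₀, uhat (ζ * ξ t) = uhat (ξ t) := hξtend.eventually hinv
  obtain ⟨r', hr', hball⟩ := Metric.eventually_nhds_iff_ball.1 (e1.and (e2.and (e3.and e4)))
  refine ⟨r', hr', fun t ht htz => ?_⟩
  obtain ⟨ht1, ht2, ht3, ht4⟩ := hball t ht
  set s : ℂ := ξ.symm (ζ * ξ t) with hs_def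
  have hs3 : s ∈ ball z₀ (min r ρ) := ht3
  have hsr : s ∈ ball z₀ r := ball_subset_ball (min_le_left _ _) hs3
  have hsρ : s ∈ ball z₀ ρ := ball_subset_ball (min_le_right _ _) hs3
  have hξs : ξ s = ζ * ξ t := ξ.right_inv ht2
  refine ⟨s, hsr, ?_, ?_⟩
  · -- `s ≠ t`: otherwise `ξ t = ζ ξ t`, so `ξ t = 0 = ξ z₀` and `t = z₀`
    intro hst
    have h1 : (ζ - 1) * ξ t = 0 := by rw [sub_mul, one_mul, ← hξs, hst, sub_self]
    have h2 : ξ t = 0 := by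
      rcases mul_eq_zero.1 h1 with h | h
      · exact absurd (sub_eq_zero.1 h) hζ1
      · exact h
    have h3 : t = z₀ := ξ.injOn (hξsrc ht1) hz₀src (by rw [h2, hξ0])
    exact htz h3
  · -- `u s = u t`: both have the same image under the chart `Θ`
    obtain ⟨hs_src, hs_rep⟩ := hrep s hsρ
    obtain ⟨ht_src, ht_rep⟩ := hrep t ht1
    have hΘ : Θ (u s) = Θ (u t) := by
      rw [hs_rep, ht_rep, hξs, mul_pow, hζk, one_mul, ht4]
    exact Θ.injOn hs_src ht_src hΘ

/-- **Injective case.** If, in the representation `Θ (u z) = ((ξ z)^k, û (ξ z))` near `z₀`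
(`Θ`, `ξ` being `C¹` charts with `C¹` inverses, `û ∈ C¹`), for every nontrivial `k`-th root of
unity `ζ` the normal coordinates of `u` and of its `ζ`-rotation differ on a punctured
neighbourhood of `0` (`û (ζ w) ≠ û w`), then `u` is injective on a disc about `z₀` and immersed on
the punctured disc (Wendl 2020, proof of Prop. B.41: self-intersections `u z = u ζ'` correspond to
roots `ζ ≠ 1` and zeros of `û (ζ ·) - û`; off `z₀` the first coordinate `w ↦ w^k` is immersive).
[cite: Wendl2020, App. B, proof of Prop. B.41] -/
theorem localBranch_injOn_of_rotations_ne [NormedSpace ℝ F] {u : ℂ → F} {z₀ : ℂ} {k : ℕ}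
    {Θ : OpenPartialHomeomorph F (ℂ × ℂ)} {ξ : OpenPartialHomeomorph ℂ ℂ} {uhat : ℂ → ℂ}
    {ρ ρ₁ : ℝ} (hk : 0 < k) (hρ : 0 < ρ)
    (hΘ : ContDiffOn ℝ 1 Θ Θ.source) (hΘsymm : ContDiffOn ℝ 1 Θ.symm Θ.target)
    (hξsrc : ball z₀ ρ ⊆ ξ.source) (hξ0 : ξ z₀ = 0) (hξ : ContDiffOn ℝ 1 ξ ξ.source)
    (hξsymm : ContDiffOn ℝ 1 ξ.symm ξ.target)
    (hξρ : MapsTo ξ (ball z₀ ρ) (ball 0 ρ₁)) (huhat : ContDiffOn ℝ 1 uhat (ball 0 ρ₁))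
    (hrep : ∀ z ∈ ball z₀ ρ, u z ∈ Θ.source ∧ Θ (u z) = ((ξ z) ^ k, uhat (ξ z)))
    (hne : ∀ ζ : ℂ, ζ ^ k = 1 → ζ ≠ 1 → ∀ᶠ w in 𝓝[≠] (0 : ℂ), uhat (ζ * w) ≠ uhat w) :
    ∃ ρ' : ℝ, 0 < ρ' ∧ InjOn u (ball z₀ ρ') ∧
      ∀ z ∈ ball z₀ ρ', z ≠ z₀ → Injective (fderiv ℝ u z) := by
  have hz₀src : z₀ ∈ ξ.source := hξsrc (mem_ball_self hρ)
  have hξtend : Tendsto ξ (𝓝 z₀) (𝓝 0) := by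
    simpa [hξ0] using (ξ.continuousAt hz₀src).tendsto
  -- a uniform punctured disc `0 < ‖w‖ < δ` on which `û (ζ w) ≠ û w` for all roots `ζ ≠ 1`
  set S : Finset ℂ := (Polynomial.nthRoots k (1 : ℂ)).toFinset with hS_def
  have hS : ∀ ζ : ℂ, ζ ∈ S ↔ ζ ^ k = 1 := fun ζ => by
    rw [hS_def, Multiset.mem_toFinset, Polynomial.mem_nthRoots hk]
  have hall : ∀ᶠ w in 𝓝[≠] (0 : ℂ), ∀ ζ ∈ S, ζ ≠ 1 → uhat (ζ * w) ≠ uhat w := by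
    rw [eventually_all_finset]
    intro ζ hζ
    by_cases h1 : ζ = 1
    · exact Eventually.of_forall fun w h => absurd h1 h
    · exact (hne ζ ((hS ζ).1 hζ) h1).mono fun w hw _ => hw
  obtain ⟨δ, hδ, hδball⟩ := Metric.eventually_nhds_iff_ball.1 (eventually_nhdsWithin_iff.1 hall)
  -- a disc about `z₀` mapped by `ξ` into `‖w‖ < δ`
  have e1 : ∀ᶠ t in 𝓝 z₀, t ∈ ball z₀ ρ := isOpen_ball.mem_nhds (mem_ball_self hρ)
  have e2 : ∀ᶠ t in 𝓝 z₀, ξ t ∈ ball (0 : ℂ) δ := hξtend (ball_mem_nhds 0 hδ)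
  obtain ⟨ρ', hρ', hρ'ball⟩ := Metric.eventually_nhds_iff_ball.1 (e1.and e2)
  refine ⟨ρ', hρ', ?_, ?_⟩
  · -- injectivity
    intro s hs t ht hst
    obtain ⟨hsρ, hsδ⟩ := hρ'ball s hs
    obtain ⟨htρ, htδ⟩ := hρ'ball t ht
    obtain ⟨hs_src, hs_rep⟩ := hrep s hsρ
    obtain ⟨ht_src, ht_rep⟩ := hrep t htρ
    have hΘeq : ((ξ s) ^ k, uhat (ξ s)) = ((ξ t) ^ k, uhat (ξ t)) := by
      rw [← hs_rep, ← ht_rep, hst]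
    simp only [Prod.mk.injEq] at hΘeq
    obtain ⟨hpow, huh⟩ := hΘeq
    have key : ξ s = ξ t := by
      by_cases ht0 : ξ t = 0
      · rw [ht0] at hpow ⊢
        rw [zero_pow hk.ne'] at hpow
        exact pow_eq_zero_iff hk.ne' |>.1 hpow
      · set ζ : ℂ := ξ s / ξ t with hζ_def
        have hζk : ζ ^ k = 1 := by
          rw [hζ_def, div_pow, hpow, div_self (pow_ne_zero _ ht0)]
        have hζs : ζ * ξ t = ξ s := div_mul_cancel₀ (ξ s) ht0
        by_contra hneq
        have hζ1 : ζ ≠ 1 := by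
          intro h1
          rw [h1, one_mul] at hζs
          exact hneq hζs.symm
        have := hδball (ξ t) htδ ht0 ζ ((hS ζ).2 hζk) hζ1
        rw [hζs] at this
        exact this huh
    exact ξ.injOn (hξsrc hsρ) (hξsrc htρ) key
  · -- immersion off `z₀`
    intro z hz hzz₀
    obtain ⟨hzρ, -⟩ := hρ'ball z hz
    have hz_src : z ∈ ξ.source := hξsrc hzρ
    have hξz : ξ z ≠ 0 := by
      intro h0
      exact hzz₀ (ξ.injOn hz_src hz₀src (by rw [h0, hξ0]))
    obtain ⟨huz_src, huz_rep⟩ := hrep z hzρ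
    have htgt : Θ (u z) ∈ Θ.target := Θ.map_source huz_src
    -- differentiability of the three factors
    have hξd : DifferentiableAt ℝ ξ z :=
      (hξ.differentiableOn one_ne_zero).differentiableAt (ξ.open_source.mem_nhds hz_src)
    have hξsd : DifferentiableAt ℝ ξ.symm (ξ z) :=
      (hξsymm.differentiableOn one_ne_zero).differentiableAt
        (ξ.open_target.mem_nhds (ξ.map_source hz_src))
    have huhd : DifferentiableAt ℝ uhat (ξ z) :=
      (huhat.differentiableOn one_ne_zero).differentiableAt (isOpen_ball.mem_nhds (hξρ hzρ))
    have hNd : DifferentiableAt ℝ (fun w : ℂ => (w ^ k, uhat w)) (ξ z) :=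
      ((differentiableAt_pow (𝕜 := ℂ) k (x := ξ z)).restrictScalars ℝ).prodMk huhd
    have hΘsd : DifferentiableAt ℝ Θ.symm (Θ (u z)) :=
      (hΘsymm.differentiableOn one_ne_zero).differentiableAt (Θ.open_target.mem_nhds htgt)
    have hΘd : DifferentiableAt ℝ Θ (Θ.symm (Θ (u z))) := by
      rw [Θ.left_inv huz_src]
      exact (hΘ.differentiableOn one_ne_zero).differentiableAt (Θ.open_source.mem_nhds huz_src)
    -- `u = Θ⁻¹ ∘ N ∘ ξ` near `z`
    have hueq : u =ᶠ[𝓝 z] (Θ.symm ∘ (fun w : ℂ => (w ^ k, uhat w)) ∘ ξ) := by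
      filter_upwards [isOpen_ball.mem_nhds hzρ] with z' hz'
      obtain ⟨h1, h2⟩ := hrep z' hz'
      simp only [Function.comp_apply]
      rw [← h2]
      exact (Θ.left_inv h1).symm
    rw [hueq.fderiv_eq]
    have hNd' : DifferentiableAt ℝ (fun w : ℂ => (w ^ k, uhat w)) (ξ z) := hNd
    have hΘsd' : DifferentiableAt ℝ Θ.symm (((fun w : ℂ => (w ^ k, uhat w)) ∘ ξ) z) := by
      simp only [Function.comp_apply]
      rw [← huz_rep]
      exact hΘsd
    rw [fderiv_comp z hΘsd' (hNd'.comp z hξd), fderiv_comp z hNd' hξd,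
      ContinuousLinearMap.coe_comp, ContinuousLinearMap.coe_comp]
    have heq : ((fun w : ℂ => (w ^ k, uhat w)) ∘ ξ) z = Θ (u z) := by
      simp only [Function.comp_apply]; rw [← huz_rep]
    have hA : Injective (fderiv ℝ Θ.symm (((fun w : ℂ => (w ^ k, uhat w)) ∘ ξ) z)) := by
      rw [heq]
      exact injective_fderiv_of_eventually_leftInverse hΘsd hΘd
        (Θ.eventually_right_inverse htgt)
    have hB : Injective (fderiv ℝ (fun w : ℂ => (w ^ k, uhat w)) (ξ z)) :=
      injective_fderiv_pow_prodMk hk.ne' hξz huhd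
    have hC : Injective (fderiv ℝ ξ z) :=
      injective_fderiv_of_eventually_leftInverse hξd hξsd (ξ.eventually_left_inverse hz_src)
    exact hA.comp (hB.comp hC)

/-- `exp (2πiℓ/k)` is a `k`-th root of unity (`k ≠ 0`). [folklore] -/
theorem exp_two_pi_mul_I_div_pow_eq_one (ℓ k : ℕ) (hk : k ≠ 0) :
    Complex.exp (2 * Real.pi * Complex.I * (ℓ / k : ℂ)) ^ k = 1 := by
  rw [← Complex.exp_nat_mul]
  have : (k : ℂ) * (2 * Real.pi * Complex.I * (ℓ / k : ℂ)) = ℓ * (2 * Real.pi * Complex.I) := by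
    field_simp
  rw [this]
  exact Complex.exp_nat_mul_two_pi_mul_I ℓ

/-- **Local branch dichotomy from the representation formula, flat form** (Wendl 2020,
Prop. B.41, first paragraph of the proof). Given the conclusion of the representation formula
(Thm. B.23) for `u` at `z₀` — charts `Θ`, `ξ`, exponent `k ≥ 1`, normal coordinate `û`, and for
each rotation `w ↦ e^{2πiℓ/k} w` the comparison "`û (e^{2πiℓ/k} w) = û w` near `0`, or
`û (e^{2πiℓ/k} w) - û w = C w^m + o(|w|^m)` with `C ≠ 0`" — EITHER `u` is injective on a disc
about `z₀` and immersed on the punctured disc, OR for every `r > 0` there is `r' > 0` such that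
every `t ≠ z₀` in `B(z₀, r')` has a partner `s ≠ t` in `B(z₀, r)` with `u s = u t`.
[cite: Wendl2020, App. B, Prop. B.41 (proof)] -/
theorem localBranchDichotomy_flat_of_representation [NormedSpace ℝ F] {u : ℂ → F} {z₀ : ℂ}
    {k : ℕ} {Θ : OpenPartialHomeomorph F (ℂ × ℂ)} {ξ : OpenPartialHomeomorph ℂ ℂ} {uhat : ℂ → ℂ}
    {ρ ρ₁ : ℝ} (hk : 0 < k) (hρ : 0 < ρ)
    (hΘ : ContDiffOn ℝ 1 Θ Θ.source) (hΘsymm : ContDiffOn ℝ 1 Θ.symm Θ.target)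
    (hξsrc : ball z₀ ρ ⊆ ξ.source) (hξ0 : ξ z₀ = 0) (hξ : ContDiffOn ℝ 1 ξ ξ.source)
    (hξsymm : ContDiffOn ℝ 1 ξ.symm ξ.target)
    (hξρ : MapsTo ξ (ball z₀ ρ) (ball 0 ρ₁)) (huhat : ContDiffOn ℝ 1 uhat (ball 0 ρ₁))
    (hrep : ∀ z ∈ ball z₀ ρ, u z ∈ Θ.source ∧ Θ (u z) = ((ξ z) ^ k, uhat (ξ z)))
    (hcmp : ∀ ℓ : ℕ,
      (∀ᶠ w in 𝓝 (0 : ℂ),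
        uhat (Complex.exp (2 * Real.pi * Complex.I * (ℓ / k : ℂ)) * w) = uhat w) ∨
      ∃ (m : ℕ) (C : ℂ), k < m ∧ C ≠ 0 ∧
        (fun w : ℂ =>
            uhat (Complex.exp (2 * Real.pi * Complex.I * (ℓ / k : ℂ)) * w) - uhat w - C * w ^ m)
          =o[𝓝 (0 : ℂ)] fun w : ℂ => ‖w‖ ^ m) :
    (∃ ρ' : ℝ, 0 < ρ' ∧ InjOn u (ball z₀ ρ') ∧
      ∀ z ∈ ball z₀ ρ', z ≠ z₀ → Injective (fderiv ℝ u z)) ∨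
    (∀ r : ℝ, 0 < r → ∃ r' : ℝ, 0 < r' ∧
      ∀ t ∈ ball z₀ r', t ≠ z₀ → ∃ s ∈ ball z₀ r, s ≠ t ∧ u s = u t) := by
  by_cases H : ∃ ℓ : ℕ, Complex.exp (2 * Real.pi * Complex.I * (ℓ / k : ℂ)) ≠ 1 ∧
      ∀ᶠ w in 𝓝 (0 : ℂ), uhat (Complex.exp (2 * Real.pi * Complex.I * (ℓ / k : ℂ)) * w) = uhat w
  · obtain ⟨ℓ, hζ1, hinv⟩ := H
    exact Or.inr (localBranch_partners_of_rotationInvariant hρ hξsrc hξ0 hrep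
      (exp_two_pi_mul_I_div_pow_eq_one ℓ k hk.ne') hζ1 hinv)
  · refine Or.inl (localBranch_injOn_of_rotations_ne hk hρ hΘ hΘsymm hξsrc hξ0 hξ hξsymm hξρ
      huhat hrep fun ζ hζk hζ1 => ?_)
    -- `ζ = exp (2πiℓ/k)` for some `ℓ`
    have hζ0 : ζ ≠ 0 := fun h => by
      rw [h, zero_pow hk.ne'] at hζk
      exact zero_ne_one hζk
    haveI : NeZero k := ⟨hk.ne'⟩
    obtain ⟨ℓ, -, hℓ⟩ := (Complex.mem_rootsOfUnity k (Units.mk0 ζ hζ0)).1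
      ((mem_rootsOfUnity' k (Units.mk0 ζ hζ0)).2 (by simpa using hζk))
    have hℓ' : Complex.exp (2 * Real.pi * Complex.I * (ℓ / k : ℂ)) = ζ := by
      simpa using hℓ
    rcases hcmp ℓ with hinv | ⟨m, C, -, hC, hlo⟩
    · exact absurd ⟨ℓ, fun h => hζ1 (hℓ'.symm.trans h), hinv⟩ H
    · rw [hℓ'] at hlo
      exact (eventually_ne_zero_of_isLittleO_sub_mul_pow hC hlo).mono fun w hw =>
        sub_ne_zero.1 hw

/-- **Local branch dichotomy from the representation formula, flat form** (Wendl 2020,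
Prop. B.41, first paragraph of the proof). Given the conclusion of the representation formula
(Thm. B.23) for `u` at `z₀` — charts `Θ`, `ξ`, exponent `k ≥ 1`, normal coordinate `û`, and for
each rotation `w ↦ e^{2πiℓ/k} w` the ZERO DICHOTOMY "`û (e^{2πiℓ/k} w) = û w` near `0`, or
`û (e^{2πiℓ/k} w) ≠ û w` on a punctured neighbourhood of `0`" (the form the proof of Prop. B.41
actually uses; it follows from the expansion `C w^m + o(|w|^m)` of Thm. B.23 and, more cheaply,
from the `C¹` zero dichotomy for `∂̄`-inequalities applied in §B.2.5) — EITHER `u` is injective on a disc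
about `z₀` and immersed on the punctured disc, OR for every `r > 0` there is `r' > 0` such that
every `t ≠ z₀` in `B(z₀, r')` has a partner `s ≠ t` in `B(z₀, r)` with `u s = u t`.
[cite: Wendl2020, App. B, Prop. B.41 (proof)] -/
theorem localBranchDichotomy_flat_of_representation' [NormedSpace ℝ F] {u : ℂ → F} {z₀ : ℂ}
    {k : ℕ} {Θ : OpenPartialHomeomorph F (ℂ × ℂ)} {ξ : OpenPartialHomeomorph ℂ ℂ} {uhat : ℂ → ℂ}
    {ρ ρ₁ : ℝ} (hk : 0 < k) (hρ : 0 < ρ)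
    (hΘ : ContDiffOn ℝ 1 Θ Θ.source) (hΘsymm : ContDiffOn ℝ 1 Θ.symm Θ.target)
    (hξsrc : ball z₀ ρ ⊆ ξ.source) (hξ0 : ξ z₀ = 0) (hξ : ContDiffOn ℝ 1 ξ ξ.source)
    (hξsymm : ContDiffOn ℝ 1 ξ.symm ξ.target)
    (hξρ : MapsTo ξ (ball z₀ ρ) (ball 0 ρ₁)) (huhat : ContDiffOn ℝ 1 uhat (ball 0 ρ₁))
    (hrep : ∀ z ∈ ball z₀ ρ, u z ∈ Θ.source ∧ Θ (u z) = ((ξ z) ^ k, uhat (ξ z)))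
    (hcmp : ∀ ℓ : ℕ,
      (∀ᶠ w in 𝓝 (0 : ℂ),
        uhat (Complex.exp (2 * Real.pi * Complex.I * (ℓ / k : ℂ)) * w) = uhat w) ∨
      (∀ᶠ w in 𝓝[≠] (0 : ℂ),
        uhat (Complex.exp (2 * Real.pi * Complex.I * (ℓ / k : ℂ)) * w) ≠ uhat w)) :
    (∃ ρ' : ℝ, 0 < ρ' ∧ InjOn u (ball z₀ ρ') ∧
      ∀ z ∈ ball z₀ ρ', z ≠ z₀ → Injective (fderiv ℝ u z)) ∨
    (∀ r : ℝ, 0 < r → ∃ r' : ℝ, 0 < r' ∧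
      ∀ t ∈ ball z₀ r', t ≠ z₀ → ∃ s ∈ ball z₀ r, s ≠ t ∧ u s = u t) := by
  by_cases H : ∃ ℓ : ℕ, Complex.exp (2 * Real.pi * Complex.I * (ℓ / k : ℂ)) ≠ 1 ∧
      ∀ᶠ w in 𝓝 (0 : ℂ), uhat (Complex.exp (2 * Real.pi * Complex.I * (ℓ / k : ℂ)) * w) = uhat w
  · obtain ⟨ℓ, hζ1, hinv⟩ := H
    exact Or.inr (localBranch_partners_of_rotationInvariant hρ hξsrc hξ0 hrep
      (exp_two_pi_mul_I_div_pow_eq_one ℓ k hk.ne') hζ1 hinv)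
  · refine Or.inl (localBranch_injOn_of_rotations_ne hk hρ hΘ hΘsymm hξsrc hξ0 hξ hξsymm hξρ
      huhat hrep fun ζ hζk hζ1 => ?_)
    -- `ζ = exp (2πiℓ/k)` for some `ℓ`
    have hζ0 : ζ ≠ 0 := fun h => by
      rw [h, zero_pow hk.ne'] at hζk
      exact zero_ne_one hζk
    haveI : NeZero k := ⟨hk.ne'⟩
    obtain ⟨ℓ, -, hℓ⟩ := (Complex.mem_rootsOfUnity k (Units.mk0 ζ hζ0)).1
      ((mem_rootsOfUnity' k (Units.mk0 ζ hζ0)).2 (by simpa using hζk))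
    have hℓ' : Complex.exp (2 * Real.pi * Complex.I * (ℓ / k : ℂ)) = ζ := by
      simpa using hℓ
    rcases hcmp ℓ with hinv | hne
    · exact absurd ⟨ℓ, fun h => hζ1 (hℓ'.symm.trans h), hinv⟩ H
    · rwa [hℓ'] at hne

end Flat

/-! ### The manifold statement from the representation formula -/

section Manifold

/-- **`jHolomorphic_localBranchDichotomy` from the local representation formula (Wendl 2020,
Thm. B.23 ⇒ Prop. B.41).** HYPOTHESIS `hX`: the representation formula in dimension four, flat,
rotation form — for a real normed space `F` of dimension `4`, `U ⊆ F` open, `J` smooth on `U`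
with `J² = -1` there, and `u : ℂ → F` smooth and `J`-holomorphic on a disc `B(z₀, R)` mapped into
`U` and constant on no neighbourhood of `z₀`, there are `k ≥ 1`, a smooth chart `Θ` of `F` about
`u z₀` (smooth inverse, `Θ (u z₀) = 0`), a `C¹` chart `ξ` of `ℂ` about `z₀` (`C¹` inverse, smooth
off `z₀`, `ξ z₀ = 0`) and a `C¹` map `û = O(|w|^{k+1})` with `Θ (u z) = ((ξ z)^k, û (ξ z))` near
`z₀`, such that for every `ℓ` either `û (e^{2πiℓ/k} w) = û w` near `0` or
`û (e^{2πiℓ/k} w) - û w = C w^m + o(|w|^m)`, `C ≠ 0`, `m > k` (C. Wendl, *Lectures on Contact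
3-Manifolds, Holomorphic Curves and Intersection Theory* (2020), App. B, Thm. B.23 with the
comparison used in the proof of Prop. B.41; the 2010 notes' Thm. 2.85). CONCLUSION: the named
fact `jHolomorphic_localBranchDichotomy` (Wendl 2010 Thm. 2.88 / 2020 Prop. B.41 in dichotomy
form). Proof: localise in the chart at `G z₀` (`exists_coordinateACS_global`,
`exists_chartCurve_global`), apply `hX` to the chart expression, run the first paragraph of the
proof of Prop. B.41 (`localBranchDichotomy_flat_of_representation`), and transfer injectivity,
immersivity and partners back through the (injective) chart.
[cite: Wendl2020, App. B, Thm. B.23 and Prop. B.41] -/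
theorem jHolomorphic_localBranchDichotomy_of_representationFormula
    (hX : ∀ (F : Type) [NormedAddCommGroup F] [NormedSpace ℝ F] [FiniteDimensional ℝ F],
      Module.finrank ℝ F = 4 →
      ∀ (J : F → F →L[ℝ] F) (U : Set F), IsOpen U → ContDiffOn ℝ ∞ J U →
        (∀ x ∈ U, ∀ v : F, J x (J x v) = -v) →
      ∀ (u : ℂ → F) (z₀ : ℂ) (R : ℝ), 0 < R → ContDiffOn ℝ ∞ u (ball z₀ R) →
        MapsTo u (ball z₀ R) U →
        (∀ z ∈ ball z₀ R, ∀ α : ℂ, fderiv ℝ u z (Complex.I * α) = J (u z) (fderiv ℝ u z α)) →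
        (∃ᶠ z in 𝓝 z₀, u z ≠ u z₀) →
        ∃ (k : ℕ) (Θ : OpenPartialHomeomorph F (ℂ × ℂ)) (ξ : OpenPartialHomeomorph ℂ ℂ)
          (uhat : ℂ → ℂ) (ρ ρ₁ : ℝ),
          0 < k ∧ 0 < ρ ∧ 0 < ρ₁ ∧
          u z₀ ∈ Θ.source ∧ Θ (u z₀) = 0 ∧ ContDiffOn ℝ ∞ Θ Θ.source ∧
            ContDiffOn ℝ ∞ Θ.symm Θ.target ∧
          ball z₀ ρ ⊆ ξ.source ∧ ξ z₀ = 0 ∧ ContDiffOn ℝ 1 ξ ξ.source ∧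
            ContDiffOn ℝ 1 ξ.symm ξ.target ∧ ContDiffOn ℝ ∞ ξ (ξ.source \ {z₀}) ∧
          MapsTo ξ (ball z₀ ρ) (ball 0 ρ₁) ∧ ContDiffOn ℝ 1 uhat (ball 0 ρ₁) ∧
            (uhat =O[𝓝 0] fun w : ℂ => ‖w‖ ^ (k + 1)) ∧
            (∀ z ∈ ball z₀ ρ, u z ∈ Θ.source ∧ Θ (u z) = ((ξ z) ^ k, uhat (ξ z))) ∧
          ∀ ℓ : ℕ,
            (∀ᶠ w in 𝓝 (0 : ℂ),
              uhat (Complex.exp (2 * Real.pi * Complex.I * (ℓ / k : ℂ)) * w) = uhat w) ∨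
            ∃ (m : ℕ) (C : ℂ), k < m ∧ C ≠ 0 ∧
              (fun w : ℂ =>
                  uhat (Complex.exp (2 * Real.pi * Complex.I * (ℓ / k : ℂ)) * w) - uhat w -
                    C * w ^ m)
                =o[𝓝 (0 : ℂ)] fun w : ℂ => ‖w‖ ^ m) :
    jHolomorphic_localBranchDichotomy := by
  intro V _ _ _ _ _ J hJ2 hJsm G hG hGJ z₀ hfreq
  -- ### Step 1: chart localisation at `x₀ = G z₀`
  obtain ⟨J', δ, hδ, hJ', hJ'E, hJ'2⟩ := exists_coordinateACS_global J hJ2 hJsm (G z₀)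
  obtain ⟨u, R, hR, hu, huR, huJ, -⟩ :=
    exists_chartCurve_global J hJ'E hG hGJ (z₀ := z₀) rfl hδ
  set e := extChartAt (𝓡 4) (G z₀) with he_def
  -- the chart is injective on its domain
  have heinj : InjOn e (chartAt (EuclideanSpace ℝ (Fin 4)) (G z₀)).source := by
    rw [he_def, ← extChartAt_source (𝓡 4)]
    exact (extChartAt (𝓡 4) (G z₀)).injOn
  -- the open set carrying the coordinate almost complex structure
  set U : Set (EuclideanSpace ℝ (Fin 4)) := e.target ∩ ball (e (G z₀)) δ with hU_def
  have hUo : IsOpen U := (isOpen_extChartAt_target (I := 𝓡 4) (G z₀)).inter isOpen_ball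
  have hJ'2U : ∀ y ∈ U, ∀ v, J' y (J' y v) = -v := by
    rintro y ⟨hyt, hyδ⟩ v
    have hx : e.symm y ∈ (chartAt (EuclideanSpace ℝ (Fin 4)) (G z₀)).source := by
      rw [← extChartAt_source (𝓡 4)]
      exact (extChartAt (𝓡 4) (G z₀)).map_target hyt
    have hy : e (e.symm y) = y := (extChartAt (𝓡 4) (G z₀)).right_inv hyt
    have h := hJ'2 (e.symm y) hx (by rw [hy]; exact hyδ) v
    rwa [hy] at h
  have huU : MapsTo u (ball z₀ R) U := fun z hz => by
    obtain ⟨hsrc, huz, hball⟩ := huR z hz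
    refine ⟨?_, hball⟩
    rw [huz]
    exact (extChartAt (𝓡 4) (G z₀)).map_source (by rwa [extChartAt_source])
  -- `u` is constant on no neighbourhood of `z₀`
  have hfreq' : ∃ᶠ z in 𝓝 z₀, u z ≠ u z₀ := by
    refine hfreq.mp (eventually_of_mem (ball_mem_nhds z₀ hR) fun z hz hne heq => hne ?_)
    obtain ⟨hs, huz, -⟩ := huR z hz
    obtain ⟨hs₀, huz₀, -⟩ := huR z₀ (mem_ball_self hR)
    exact heinj hs hs₀ (by rw [← huz, ← huz₀, heq])
  -- ### Step 2: the representation formula for the chart expression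
  obtain ⟨k, Θ, ξ, uhat, ρ, ρ₁, hk, hρ, -, -, -, hΘ, hΘsymm, hξsrc, hξ0, hξ, hξsymm, -, hξρ,
    huhat, -, hrep, hcmp⟩ :=
    hX (EuclideanSpace ℝ (Fin 4)) finrank_euclideanSpace_fin J' U hUo hJ'.contDiffOn hJ'2U u z₀ R
      hR hu.contDiffOn huU huJ hfreq'
  -- ### Step 3: the flat dichotomy, transferred back through the chart
  rcases localBranchDichotomy_flat_of_representation hk hρ (hΘ.of_le (by simp))
      (hΘsymm.of_le (by simp)) hξsrc hξ0 hξ hξsymm hξρ huhat hrep hcmp with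
    ⟨ρ', hρ', hinj, himm⟩ | hB
  · -- injective germ
    refine Or.inl ⟨min ρ' R, lt_min hρ' hR, ?_, ?_⟩
    · intro s hs t ht hst
      have hsR : s ∈ ball z₀ R := ball_subset_ball (min_le_right _ _) hs
      have htR : t ∈ ball z₀ R := ball_subset_ball (min_le_right _ _) ht
      obtain ⟨-, hus, -⟩ := huR s hsR
      obtain ⟨-, hut, -⟩ := huR t htR
      exact hinj (ball_subset_ball (min_le_left _ _) hs) (ball_subset_ball (min_le_left _ _) ht)
        (by rw [hus, hut, hst])
    · intro z hz hzz₀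
      have hzR : z ∈ ball z₀ R := ball_subset_ball (min_le_right _ _) hz
      obtain ⟨hzsrc, -, -⟩ := huR z hzR
      have hev : u =ᶠ[𝓝 z] fun w : ℂ => e (G w) := by
        filter_upwards [isOpen_ball.mem_nhds hzR] with w hw using (huR w hw).2.1
      have hinjz := himm z (ball_subset_ball (min_le_left _ _) hz) hzz₀
      rw [hev.fderiv_eq] at hinjz
      intro v w hvw
      apply hinjz
      rw [he_def, ChartLocalisation.fderiv_extChartAt_comp_apply (hG z) hzsrc,
        ChartLocalisation.fderiv_extChartAt_comp_apply (hG z) hzsrc, hvw]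
  · -- branched germ: partners
    refine Or.inr fun r hr => ?_
    obtain ⟨r', hr', hpart⟩ := hB (min r R) (lt_min hr hR)
    refine ⟨min r' R, lt_min hr' hR, fun t ht htz₀ => ?_⟩
    obtain ⟨s, hs, hst, hust⟩ := hpart t (ball_subset_ball (min_le_left _ _) ht) htz₀
    refine ⟨s, ball_subset_ball (min_le_left _ _) hs, hst, ?_⟩
    obtain ⟨hssrc, hus, -⟩ := huR s (ball_subset_ball (min_le_right _ _) hs)
    obtain ⟨htsrc, hut, -⟩ := huR t (ball_subset_ball (min_le_right _ _) ht)
    exact heinj hssrc htsrc (by rw [← hus, ← hut, hust])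

/-- **`jHolomorphic_localBranchDichotomy` from the local representation formula, zero-dichotomy
form (Wendl 2020, Thm. B.23 ⇒ Prop. B.41).** Same as
`jHolomorphic_localBranchDichotomy_of_representationFormula` but with the WEAKER hypothesis `hX'` in
which the expansion `û (e^{2πiℓ/k} w) - û w = C w^m + o(|w|^m)` is replaced by what its proof uses:
`û (e^{2πiℓ/k} w) ≠ û w` on a punctured neighbourhood of `0` (or equality near `0`). In detail,
HYPOTHESIS `hX'`: the representation formula in dimension four, flat, rotation form — for a real normed space `F` of dimension `4`, `U ⊆ F` open, `J` smooth on `U`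
with `J² = -1` there, and `u : ℂ → F` smooth and `J`-holomorphic on a disc `B(z₀, R)` mapped into
`U` and constant on no neighbourhood of `z₀`, there are `k ≥ 1`, a smooth chart `Θ` of `F` about
`u z₀` (smooth inverse, `Θ (u z₀) = 0`), a `C¹` chart `ξ` of `ℂ` about `z₀` (`C¹` inverse, smooth
off `z₀`, `ξ z₀ = 0`) and a `C¹` map `û = O(|w|^{k+1})` with `Θ (u z) = ((ξ z)^k, û (ξ z))` near
`z₀`, such that for every `ℓ` either `û (e^{2πiℓ/k} w) = û w` near `0` or
`û (e^{2πiℓ/k} w) ≠ û w` for `0 < |w|` small (C. Wendl, *Lectures on Contact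
3-Manifolds, Holomorphic Curves and Intersection Theory* (2020), App. B, Thm. B.23 with the
comparison used in the proof of Prop. B.41; the 2010 notes' Thm. 2.85). CONCLUSION: the named
fact `jHolomorphic_localBranchDichotomy` (Wendl 2010 Thm. 2.88 / 2020 Prop. B.41 in dichotomy
form). Proof: localise in the chart at `G z₀` (`exists_coordinateACS_global`,
`exists_chartCurve_global`), apply `hX` to the chart expression, run the first paragraph of the
proof of Prop. B.41 (`localBranchDichotomy_flat_of_representation'`), and transfer injectivity,
immersivity and partners back through the (injective) chart.
[cite: Wendl2020, App. B, Thm. B.23 and Prop. B.41] -/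
theorem jHolomorphic_localBranchDichotomy_of_representationFormula'
    (hX' : ∀ (F : Type) [NormedAddCommGroup F] [NormedSpace ℝ F] [FiniteDimensional ℝ F],
      Module.finrank ℝ F = 4 →
      ∀ (J : F → F →L[ℝ] F) (U : Set F), IsOpen U → ContDiffOn ℝ ∞ J U →
        (∀ x ∈ U, ∀ v : F, J x (J x v) = -v) →
      ∀ (u : ℂ → F) (z₀ : ℂ) (R : ℝ), 0 < R → ContDiffOn ℝ ∞ u (ball z₀ R) →
        MapsTo u (ball z₀ R) U →
        (∀ z ∈ ball z₀ R, ∀ α : ℂ, fderiv ℝ u z (Complex.I * α) = J (u z) (fderiv ℝ u z α)) →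
        (∃ᶠ z in 𝓝 z₀, u z ≠ u z₀) →
        ∃ (k : ℕ) (Θ : OpenPartialHomeomorph F (ℂ × ℂ)) (ξ : OpenPartialHomeomorph ℂ ℂ)
          (uhat : ℂ → ℂ) (ρ ρ₁ : ℝ),
          0 < k ∧ 0 < ρ ∧ 0 < ρ₁ ∧
          u z₀ ∈ Θ.source ∧ Θ (u z₀) = 0 ∧ ContDiffOn ℝ ∞ Θ Θ.source ∧
            ContDiffOn ℝ ∞ Θ.symm Θ.target ∧
          ball z₀ ρ ⊆ ξ.source ∧ ξ z₀ = 0 ∧ ContDiffOn ℝ 1 ξ ξ.source ∧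
            ContDiffOn ℝ 1 ξ.symm ξ.target ∧ ContDiffOn ℝ ∞ ξ (ξ.source \ {z₀}) ∧
          MapsTo ξ (ball z₀ ρ) (ball 0 ρ₁) ∧ ContDiffOn ℝ 1 uhat (ball 0 ρ₁) ∧
            (uhat =O[𝓝 0] fun w : ℂ => ‖w‖ ^ (k + 1)) ∧
            (∀ z ∈ ball z₀ ρ, u z ∈ Θ.source ∧ Θ (u z) = ((ξ z) ^ k, uhat (ξ z))) ∧
          ∀ ℓ : ℕ,
            (∀ᶠ w in 𝓝 (0 : ℂ),
              uhat (Complex.exp (2 * Real.pi * Complex.I * (ℓ / k : ℂ)) * w) = uhat w) ∨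
            (∀ᶠ w in 𝓝[≠] (0 : ℂ),
              uhat (Complex.exp (2 * Real.pi * Complex.I * (ℓ / k : ℂ)) * w) ≠ uhat w)) :
    jHolomorphic_localBranchDichotomy := by
  intro V _ _ _ _ _ J hJ2 hJsm G hG hGJ z₀ hfreq
  -- ### Step 1: chart localisation at `x₀ = G z₀`
  obtain ⟨J', δ, hδ, hJ', hJ'E, hJ'2⟩ := exists_coordinateACS_global J hJ2 hJsm (G z₀)
  obtain ⟨u, R, hR, hu, huR, huJ, -⟩ :=
    exists_chartCurve_global J hJ'E hG hGJ (z₀ := z₀) rfl hδ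
  set e := extChartAt (𝓡 4) (G z₀) with he_def
  -- the chart is injective on its domain
  have heinj : InjOn e (chartAt (EuclideanSpace ℝ (Fin 4)) (G z₀)).source := by
    rw [he_def, ← extChartAt_source (𝓡 4)]
    exact (extChartAt (𝓡 4) (G z₀)).injOn
  -- the open set carrying the coordinate almost complex structure
  set U : Set (EuclideanSpace ℝ (Fin 4)) := e.target ∩ ball (e (G z₀)) δ with hU_def
  have hUo : IsOpen U := (isOpen_extChartAt_target (I := 𝓡 4) (G z₀)).inter isOpen_ball
  have hJ'2U : ∀ y ∈ U, ∀ v, J' y (J' y v) = -v := by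
    rintro y ⟨hyt, hyδ⟩ v
    have hx : e.symm y ∈ (chartAt (EuclideanSpace ℝ (Fin 4)) (G z₀)).source := by
      rw [← extChartAt_source (𝓡 4)]
      exact (extChartAt (𝓡 4) (G z₀)).map_target hyt
    have hy : e (e.symm y) = y := (extChartAt (𝓡 4) (G z₀)).right_inv hyt
    have h := hJ'2 (e.symm y) hx (by rw [hy]; exact hyδ) v
    rwa [hy] at h
  have huU : MapsTo u (ball z₀ R) U := fun z hz => by
    obtain ⟨hsrc, huz, hball⟩ := huR z hz
    refine ⟨?_, hball⟩
    rw [huz]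
    exact (extChartAt (𝓡 4) (G z₀)).map_source (by rwa [extChartAt_source])
  -- `u` is constant on no neighbourhood of `z₀`
  have hfreq' : ∃ᶠ z in 𝓝 z₀, u z ≠ u z₀ := by
    refine hfreq.mp (eventually_of_mem (ball_mem_nhds z₀ hR) fun z hz hne heq => hne ?_)
    obtain ⟨hs, huz, -⟩ := huR z hz
    obtain ⟨hs₀, huz₀, -⟩ := huR z₀ (mem_ball_self hR)
    exact heinj hs hs₀ (by rw [← huz, ← huz₀, heq])
  -- ### Step 2: the representation formula for the chart expression
  obtain ⟨k, Θ, ξ, uhat, ρ, ρ₁, hk, hρ, -, -, -, hΘ, hΘsymm, hξsrc, hξ0, hξ, hξsymm, -, hξρ,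
    huhat, -, hrep, hcmp⟩ :=
    hX' (EuclideanSpace ℝ (Fin 4)) finrank_euclideanSpace_fin J' U hUo hJ'.contDiffOn hJ'2U u z₀ R
      hR hu.contDiffOn huU huJ hfreq'
  -- ### Step 3: the flat dichotomy, transferred back through the chart
  rcases localBranchDichotomy_flat_of_representation' hk hρ (hΘ.of_le (by simp))
      (hΘsymm.of_le (by simp)) hξsrc hξ0 hξ hξsymm hξρ huhat hrep hcmp with
    ⟨ρ', hρ', hinj, himm⟩ | hB
  · -- injective germ
    refine Or.inl ⟨min ρ' R, lt_min hρ' hR, ?_, ?_⟩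
    · intro s hs t ht hst
      have hsR : s ∈ ball z₀ R := ball_subset_ball (min_le_right _ _) hs
      have htR : t ∈ ball z₀ R := ball_subset_ball (min_le_right _ _) ht
      obtain ⟨-, hus, -⟩ := huR s hsR
      obtain ⟨-, hut, -⟩ := huR t htR
      exact hinj (ball_subset_ball (min_le_left _ _) hs) (ball_subset_ball (min_le_left _ _) ht)
        (by rw [hus, hut, hst])
    · intro z hz hzz₀
      have hzR : z ∈ ball z₀ R := ball_subset_ball (min_le_right _ _) hz
      obtain ⟨hzsrc, -, -⟩ := huR z hzR
      have hev : u =ᶠ[𝓝 z] fun w : ℂ => e (G w) := by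
        filter_upwards [isOpen_ball.mem_nhds hzR] with w hw using (huR w hw).2.1
      have hinjz := himm z (ball_subset_ball (min_le_left _ _) hz) hzz₀
      rw [hev.fderiv_eq] at hinjz
      intro v w hvw
      apply hinjz
      rw [he_def, ChartLocalisation.fderiv_extChartAt_comp_apply (hG z) hzsrc,
        ChartLocalisation.fderiv_extChartAt_comp_apply (hG z) hzsrc, hvw]
  · -- branched germ: partners
    refine Or.inr fun r hr => ?_
    obtain ⟨r', hr', hpart⟩ := hB (min r R) (lt_min hr hR)
    refine ⟨min r' R, lt_min hr' hR, fun t ht htz₀ => ?_⟩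
    obtain ⟨s, hs, hst, hust⟩ := hpart t (ball_subset_ball (min_le_left _ _) ht) htz₀
    refine ⟨s, ball_subset_ball (min_le_left _ _) hs, hst, ?_⟩
    obtain ⟨hssrc, hus, -⟩ := huR s (ball_subset_ball (min_le_right _ _) hs)
    obtain ⟨htsrc, hut, -⟩ := huR t (ball_subset_ball (min_le_right _ _) ht)
    exact heinj hssrc htsrc (by rw [← hus, ← hut, hust])

end Manifold

end Literature.Geometry.Symplectic

end
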